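import Summits.NavierStokesRegularity.FluidComputer.TubeTablePost24Run0
import Summits.NavierStokesRegularity.FluidComputer.TubeTablePost24Run1
import Summits.NavierStokesRegularity.FluidComputer.TubeTablePost24Run2
import Summits.NavierStokesRegularity.FluidComputer.TubeTablePost24Run3
import Summits.NavierStokesRegularity.FluidComputer.TubeSection
import HarnessLib

/-!
# The post-ramp box as a certified stage: crossing, hand-off into the IN-TREE level table, loaded
# and correctly signed output; and its join with the thin design tube (bp3 gen 16)

HONEST FRAMING: low prior, high value-of-information experiment on Tao's machine paradigm; NOT a
claim that NS blows up.
Everything here concerns the 5-mode quadratic, energy-conserving TRUNCATION `thresholdCircuit` with an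
ABSTRACT forcing of sup-size `δ`; nothing is proved about the Navier–Stokes equations, the ramp, stage 4
or the cascade.

WHAT IS PROVED (kernel-checked chunk theorems `runP24_0 … runP24_23` composed, then the Literature soundness
theorems): `PostBox24` = the real form of `BP24` — a box of half-widths `2⁻¹⁹ / 2⁻¹⁹ / 2⁻²⁵ / √V = 2⁻¹⁴·⁵`
around the level-normalised state of the chain's downstream gate right after its input ramp (Λ = 8,
design section `k0 = 24`; bp3 gen 16 measurement).
* `postBox24_crossing`: every `Gt.δ`-forced window of duration `TfromT 24 = 4063/8192` from `PostBox24` stays in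
  the cube `‖·‖∞ ≤ Rbt` and crosses the read-out level `C₋` inside the hull `HP24 ⊆ HT`;
* `postBox24_handoff`: at the crossing the state lies in the entry box `LtL.B 0 = Bc0` of the IN-TREE re-cut
  stage-3 level table (`ThresholdLevelTableL`), the energy being placed by the box's own range
  `[EP24lo, EP24hi]/2^60 = [0.99998555, 0.99999618]` and the drift `10·Gt.δ·Rbt·TfromT 24 ≤ 1.83e-05`;
* `postBox24_reach_outputAbove`: hence (`recut_transfer_reach`) the output mode is loaded with the design
  sign, `ã ≥ zL = 0.9604`, at some time `≤ TfromT 24 + T₃L`; packaged as reach certificates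
  `postBox24Stage` (level one) and `postBox24StageLevel` (every level `c > 0`, defect `c²·Gt.δ`);
* `postBox24_joins_section`: from chunk boundary `J1 = 18` on (design time `tT 42`) every such window
  lies, at the boundary instants, in the THIN design section `Slice (24 + j)` of `TubeTable.sT` — the
  post-ramp trajectory tube merges into the certified design tube 18 chunks after the box was taken
  (rotor miss `2.63` radii at `j = 0`, inside with certified margin from `j = 18`).
So for Λ = 8 NO FATTENED TUBE and NO re-cut level table beyond the in-tree
one is needed (this supersedes the gen-15 fat-restart detour for the hand-off question): the measured post-ramp
state, with a box around it, is a certified input of the in-tree threshold-gate stage.  WHAT IS NOT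
PROVED: that the true coupled dynamics (let alone Navier–Stokes) delivers the downstream gate into
`PostBox24` — that is a float RK4 measurement of the 9-mode chain model (`code/thgate/g16/postramp_box.py`,
residual influx after that instant `≤ 1.5·10⁻⁶ < Gt.δ` in certificate units, by the same measurement).

[cite: Tao2016AveragedNS, §5.5 Thm 5.3 (5.5); §6.1 Remark 6.1]
-/

noncomputable section

open Set
open scoped Pointwise

namespace Summit.NavierStokesRegularity.FluidComputer

open Literature.Analysis.FluidPDE.Tao2016AveragedNS
open Literature.Analysis.FluidPDE.FluidComputer
open Literature.Analysis.FluidPDE.FluidComputer.TubeTable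
open Literature.Analysis.FluidPDE.FluidComputer.ThresholdLevelTable (GIt Gt Gt_valid GIt_mem Rbt)
open Literature.Analysis.FluidPDE.FluidComputer.ThresholdLevelTableL
  (LtL T₃L EoutL recut_transfer_reach LtL_B_zero LtL_C_zero)
open TubeTablePost24

namespace TubeStage

/-- Every prefix of the post-ramp run passes: chunks `0 … j-1` from `sP24 0` end in `sP24 j`. [folklore] -/
theorem run_prefixP24 {j : ℕ} (hj : j ≤ NP24) :
    runTube 60 12 GIt CLt Rt (sP24 0) ((List.range j).flatMap cP24) = some (sP24 j) :=
  runTube_chunks sP24 cP24 j (by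
    intro i hi
    have hi' : i < NP24 := lt_of_lt_of_le hi hj
    simp only [NP24] at hi'
    interval_cases i
    · exact runP24_0
    · exact runP24_1
    · exact runP24_2
    · exact runP24_3
    · exact runP24_4
    · exact runP24_5
    · exact runP24_6
    · exact runP24_7
    · exact runP24_8
    · exact runP24_9
    · exact runP24_10
    · exact runP24_11
    · exact runP24_12
    · exact runP24_13
    · exact runP24_14
    · exact runP24_15
    · exact runP24_16
    · exact runP24_17
    · exact runP24_18
    · exact runP24_19
    · exact runP24_20
    · exact runP24_21
    · exact runP24_22
    · exact runP24_23
)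

/-- The whole post-ramp run: all 24 chunks pass. [folklore] -/
theorem run_allP24 : runTube 60 12 GIt CLt Rt (sP24 0) schedP24 = some (sP24 NP24) := run_prefixP24 le_rfl

/-- **The post-ramp box** (real form of `BP24`). [folklore] -/
def PostBox24 : Set (Fin 5 → ℝ) := {X | (BP24.toR 60).mem X}

/-- [folklore] -/
theorem mem_postBox24_iff {X : Fin 5 → ℝ} : X ∈ PostBox24 ↔ (BP24.toR 60).mem X := Iff.rfl

/-- The rotor pair on the box: `|d - d_c| ≤ RD/2^60`, `|ã - z_c| ≤ RZ/2^60`. [folklore] -/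
theorem postBox24_rotor {X : Fin 5 → ℝ} (hX : X ∈ PostBox24) :
    ((2055792738579557 : ℝ) / 2 ^ 60 ≤ X 3 ∧ X 3 ≤ (2126161482757223 : ℝ) / 2 ^ 60) ∧ ((12925130919758888 : ℝ) / 2 ^ 60 ≤ X 4 ∧ X 4 ≤ (13024647352142104 : ℝ) / 2 ^ 60) := by
  obtain ⟨-, -, -, gV⟩ := hX
  simp only [TubeBoxD.toR, BP24] at gV
  push_cast at gV
  have hd : (X 3 - (2090977110668390 : ℝ) / 2 ^ 60) ^ 2 ≤ ((35184372088833 : ℝ) / 2 ^ 60) ^ 2 := by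
    nlinarith [gV, sq_nonneg (X 4 - (12974889135950496 : ℝ) / 2 ^ 60)]
  have hz : (X 4 - (12974889135950496 : ℝ) / 2 ^ 60) ^ 2 ≤ ((49758216191608 : ℝ) / 2 ^ 60) ^ 2 := by
    nlinarith [gV, sq_nonneg (X 3 - (2090977110668390 : ℝ) / 2 ^ 60)]
  obtain ⟨hd1, hd2⟩ := abs_le_of_sq_le_sq' hd (by positivity)
  obtain ⟨hz1, hz2⟩ := abs_le_of_sq_le_sq' hz (by positivity)
  refine ⟨⟨?_, ?_⟩, ⟨?_, ?_⟩⟩ <;> norm_num at hd1 hd2 hz1 hz2 ⊢ <;> linarith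

/-- The energy range of the post-ramp box. [folklore] -/
theorem postBox24_energy_mem {X : Fin 5 → ℝ} (hX : X ∈ PostBox24) :
    (EP24lo : ℝ) / 2 ^ 60 ≤ energy X ∧ energy X ≤ (EP24hi : ℝ) / 2 ^ 60 := by
  obtain ⟨⟨hd1, hd2⟩, ⟨hz1, hz2⟩⟩ := postBox24_rotor hX
  obtain ⟨⟨ga1, ga2⟩, ⟨gb1, gb2⟩, ⟨gc1, gc2⟩, -⟩ := hX
  simp only [TubeBoxD.toR, BP24] at ga1 ga2 gb1 gb2 gc1 gc2
  push_cast at ga1 ga2 gb1 gb2 gc1 gc2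
  rw [Ignition.energy_five]
  have a0 : (0 : ℝ) ≤ X 0 := le_trans (by norm_num) ga1
  have b0 : (0 : ℝ) ≤ X 1 := le_trans (by norm_num) gb1
  have c0 : (0 : ℝ) ≤ X 2 := le_trans (by norm_num) gc1
  have d0 : (0 : ℝ) ≤ X 3 := le_trans (by norm_num) hd1
  have z0 : (0 : ℝ) ≤ X 4 := le_trans (by norm_num) hz1
  constructor
  · have e0 := pow_le_pow_left₀ (by norm_num) ga1 2
    have e1 := pow_le_pow_left₀ (by norm_num) gb1 2
    have e2 := pow_le_pow_left₀ (by norm_num) gc1 2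
    have e3 := pow_le_pow_left₀ (by norm_num) hd1 2
    have e4 := pow_le_pow_left₀ (by norm_num) hz1 2
    have num : (EP24lo : ℝ) / 2 ^ 60 ≤ ((1144968159849622912 : ℝ) / 2 ^ 60) ^ 2 + ((134482020549451056 : ℝ) / 2 ^ 60) ^ 2 + ((9761913251122 : ℝ) / 2 ^ 60) ^ 2 +
        ((2055792738579557 : ℝ) / 2 ^ 60) ^ 2 + ((12925130919758888 : ℝ) / 2 ^ 60) ^ 2 := by norm_num [EP24lo]
    linarith
  · have e0 := pow_le_pow_left₀ a0 ga2 2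
    have e1 := pow_le_pow_left₀ b0 gb2 2
    have e2 := pow_le_pow_left₀ c0 gc2 2
    have e3 := pow_le_pow_left₀ d0 hd2 2
    have e4 := pow_le_pow_left₀ z0 hz2 2
    have num : ((1144972557896134016 : ℝ) / 2 ^ 60) ^ 2 + ((134486418595962160 : ℝ) / 2 ^ 60) ^ 2 + ((9830632727858 : ℝ) / 2 ^ 60) ^ 2 + ((2126161482757223 : ℝ) / 2 ^ 60) ^ 2 +
        ((13024647352142104 : ℝ) / 2 ^ 60) ^ 2 ≤ (EP24hi : ℝ) / 2 ^ 60 := by norm_num [EP24hi]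
    linarith

/-- **CROSSING FROM THE POST-RAMP BOX**, inside the hull `HP24`. [folklore] -/
theorem postBox24_crossing {y : ℝ → Fin 5 → ℝ}
    (hW : IsForcedWindow Gt.ε Gt.σ Gt.ν Gt.μ Gt.r Gt.κ Gt.δ (TfromT 24) y) (h0 : y 0 ∈ PostBox24) :
    (∀ t ∈ Icc 0 (TfromT 24), ∀ i, |y t i| ≤ Rbt) ∧
      ∃ s ∈ Ico 0 (TfromT 24), y s 2 = Cminus ∧ HP24.memR 60 (y s) := by
  rw [← dur_schedP24] at hW
  have h := runTube_crossing (P := 60) (n := 12) (by norm_num) GIt_mem Gt_valid run_allP24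
    schedP24_ne_nil levels_ltP24.1 levels_ltP24.2 hW h0
  rw [dur_schedP24, Rt_eq] at h
  exact h

/-- **HAND-OFF FROM THE POST-RAMP BOX** into the entry box `LtL.B 0 = Bc0` of the IN-TREE re-cut level
table: carrier / clock / output from `HP24 ⊆ HT`, slaving residual by interval product over `HT`, energy
from the box's range and the drift. [folklore] -/
theorem postBox24_handoff {y : ℝ → Fin 5 → ℝ}
    (hW : IsForcedWindow Gt.ε Gt.σ Gt.ν Gt.μ Gt.r Gt.κ Gt.δ (TfromT 24) y) (h0 : y 0 ∈ PostBox24) :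
    ∃ s ∈ Ico 0 (TfromT 24), (LtL.B 0).mem Gt.κ Gt.r (LtL.C 0) (y s) := by
  obtain ⟨hcube, s, hs, hc, hHP⟩ := postBox24_crossing hW h0
  refine ⟨s, hs, ?_⟩
  have hH := HullD.memR_mono HP24_sub_HT hHP
  obtain ⟨⟨ha1, ha2⟩, ⟨hb1, hb2⟩, ⟨hd1, hd2⟩, ⟨hz1, hz2⟩⟩ := hH
  simp only [HT] at ha1 ha2 hb1 hb2 hd1 hd2 hz1 hz2
  push_cast at ha1 ha2 hb1 hb2 hd1 hd2 hz1 hz2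
  have hc' : y s 2 = (117685124146233 : ℝ) / 2 ^ 60 := by rw [hc]; norm_num [Cminus, CLt]
  have hw := slavingResidual_mem_of_box (κ := Gt.κ) (r := Gt.r) (by norm_num [Gt]) (by norm_num [Gt])
    (by norm_num) (by norm_num) (by norm_num) (by norm_num) ⟨ha1, ha2⟩ ⟨hc'.ge, hc'.le⟩ ⟨hd1, hd2⟩
    ⟨hz1, hz2⟩
  simp only [Gt] at hw
  have hdrift := hW.energy_abs_sub_le (R := Rbt) (by norm_num [Rbt])
    (fun t ht i => hcube t ⟨ht.1, ht.2.le⟩ i) s ⟨hs.1, hs.2.le⟩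
  obtain ⟨hdr1, hdr2⟩ := abs_le.1 hdrift
  have hKs : 10 * (Gt.δ * Rbt) * s ≤ 10 * (Gt.δ * Rbt) * TfromT 24 :=
    mul_le_mul_of_nonneg_left hs.2.le (by norm_num [Gt, Rbt])
  rw [TfromT_24] at hKs
  have F1 : (1152852480645929139 : ℝ) / 2 ^ 60 ≤
      (EP24lo : ℝ) / 2 ^ 60 - 10 * (Gt.δ * Rbt) * (4063 / 8192) := by
    norm_num [EP24lo, Gt, Rbt]
  have F2 : (EP24hi : ℝ) / 2 ^ 60 + 10 * (Gt.δ * Rbt) * (4063 / 8192) ≤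
      (1152990529000121906 : ℝ) / 2 ^ 60 := by
    norm_num [EP24hi, Gt, Rbt]
  obtain ⟨hE1, hE2⟩ := postBox24_energy_mem h0
  rw [LtL_B_zero, LtL_C_zero]
  refine ⟨⟨?_, ?_⟩, ⟨?_, ?_⟩, ?_, ⟨?_, ?_⟩, ⟨?_, ?_⟩, ⟨?_, ?_⟩⟩
  all_goals try simp only [LevelEntryD.toReal, ThresholdLevelTableL.Bc0]
  all_goals try push_cast
  · exact ha1
  · exact ha2
  · exact hb1
  · exact hb2
  · exact hc'
  · simp only [Gt]; linarith [hw.1]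
  · simp only [Gt]; linarith [hw.2]
  · exact hz1
  · exact hz2
  · linarith
  · linarith

/-- **REACH FROM THE POST-RAMP BOX: loaded output** `ã² ≥ EoutL ≥ 0.9224`. [cite: Tao2016AveragedNS, §5.5 Thm 5.3 (5.5)] -/
theorem postBox24_reach_outputLoaded {y : ℝ → Fin 5 → ℝ}
    (hW : IsForcedWindow Gt.ε Gt.σ Gt.ν Gt.μ Gt.r Gt.κ Gt.δ (TfromT 24 + T₃L) y) (h0 : y 0 ∈ PostBox24) :
    ∃ s ∈ Icc 0 (TfromT 24 + T₃L), EoutL ≤ y s 4 ^ 2 := by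
  have hT3 : 0 ≤ T₃L := by norm_num [T₃L]
  have hTP : 0 ≤ TfromT 24 := TfromT_nonneg 24
  obtain ⟨s, hs, hmem⟩ := postBox24_handoff (hW.mono (by linarith)) h0
  have hW3 : IsForcedWindow Gt.ε Gt.σ Gt.ν Gt.μ Gt.r Gt.κ Gt.δ T₃L (fun t => y (s + t)) :=
    (hW.shift ⟨hs.1, by linarith [hs.2]⟩).mono (by linarith [hs.2])
  obtain ⟨t, ht, hout⟩ := recut_transfer_reach hmem (x := fun t => y (s + t)) (by simp)
    hW3.continuousOn hW3.defect
  exact ⟨s + t, ⟨by linarith [hs.1, ht.1], by linarith [hs.2, ht.2]⟩, hout⟩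

/-- **REACH FROM THE POST-RAMP BOX with the design sign**: `ã ≥ zL = 0.9604`. [cite: Tao2016AveragedNS, §5.5 Thm 5.3 (5.5)] -/
theorem postBox24_reach_outputAbove {y : ℝ → Fin 5 → ℝ}
    (hW : IsForcedWindow Gt.ε Gt.σ Gt.ν Gt.μ Gt.r Gt.κ Gt.δ (TfromT 24 + T₃L) y) (h0 : y 0 ∈ PostBox24) :
    ∃ s ∈ Icc 0 (TfromT 24 + T₃L), y s ∈ outputAbove zL := by
  obtain ⟨s, hs, hsq⟩ := postBox24_reach_outputLoaded hW h0
  refine ⟨s, hs, ?_⟩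
  have hfl := hW.output_ge_affine (by norm_num [Gt]) s hs
  have h4 : (0 : ℝ) ≤ y 0 4 := le_trans (by norm_num) (postBox24_rotor h0).2.1
  have hT : TfromT 24 + T₃L ≤ 1.4142 := by
    have h1 := tT_add_TfromT (k := 24) (by norm_num [NT])
    have h2 := tT_nonneg 24
    have h3 : T12t + T₃L ≤ 1.4142 := certificate_numbers.2.2.1
    linarith
  have hδs : Gt.δ * s ≤ 1 / 10 ^ 5 := by
    have h1 : Gt.δ ≤ 4 / 10 ^ 6 := by norm_num [Gt]
    have h2 : s ≤ 1.4142 := hs.2.trans hT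
    have h3 : (0 : ℝ) ≤ Gt.δ := by norm_num [Gt]
    nlinarith [hs.1]
  have hlow : -(7 / 10 ^ 4 : ℝ) ≤ y s 4 := by linarith
  rw [mem_outputAbove]
  by_contra hlt
  rw [not_le] at hlt
  have hz := zL_sq_le_EoutL
  have hE : (0.9224 : ℝ) ≤ EoutL := certificate_numbers.1
  by_cases hnn : 0 ≤ y s 4
  · have : y s 4 ^ 2 < zL ^ 2 := by nlinarith [zL_pos]
    linarith
  · rw [not_le] at hnn
    have : y s 4 ^ 2 ≤ (7 / 10 ^ 4) ^ 2 := by nlinarith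
    norm_num at this
    linarith

/-- **The energy budget of the post-ramp stage**: `E(p) + 10·Gt.δ·Rbt·(TfromT 24 + T₃L) < Rbt²`. [folklore] -/
theorem postBox24_energy_budget {p : Fin 5 → ℝ} (hp : p ∈ PostBox24) :
    energy p + 10 * (Gt.δ * Rbt) * (TfromT 24 + T₃L) < Rbt ^ 2 := by
  have hE2 := (postBox24_energy_mem hp).2
  have hT : TfromT 24 + T₃L ≤ 1.4142 := by
    have h1 := tT_add_TfromT (k := 24) (by norm_num [NT])
    have h2 := tT_nonneg 24
    have h3 : T12t + T₃L ≤ 1.4142 := certificate_numbers.2.2.1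
    linarith
  have hK : 10 * (Gt.δ * Rbt) * (TfromT 24 + T₃L) ≤ 6 / 10 ^ 5 := by
    have h1 : 10 * (Gt.δ * Rbt) ≤ 4 / 10 ^ 5 := by norm_num [Gt, Rbt]
    have h0 : 0 ≤ TfromT 24 + T₃L := by have := TfromT_nonneg 24; norm_num [T₃L]; linarith
    nlinarith
  have hhi : (EP24hi : ℝ) / 2 ^ 60 ≤ 10001 / 10000 := by norm_num [EP24hi]
  have hRb2 : (106 : ℝ) / 100 ≤ Rbt ^ 2 := by norm_num [Rbt]
  linarith

/-- **THE STAGE FROM THE POST-RAMP BOX** (level one): a reach certificate over the whole mode space,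
defect `Gt.δ`, cycle `TfromT 24 + T₃L`, from `PostBox24` to the loaded, correctly signed output `ã ≥ zL`;
tube = the energy tube at radius `Rbt`. [cite: Tao2016AveragedNS, §5.5 Thm 5.3 (5.5)] -/
def postBox24Stage :
    ReachCertificate (thresholdCircuit Gt.ε Gt.σ Gt.ν Gt.μ Gt.r Gt.κ) univ Gt.δ (TfromT 24 + T₃L)
      PostBox24 (outputAbove zL) :=
  stageOfReachFree Gt.ε Gt.σ Gt.ν Gt.μ Gt.r Gt.κ Gt.δ Rbt (TfromT 24 + T₃L) PostBox24 (outputAbove zL)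
    (by norm_num [Gt]) (by norm_num [Gt]) (by norm_num [Rbt]) (fun _ hp => postBox24_energy_budget hp)
    (fun p hp x hx0 hW => postBox24_reach_outputAbove hW (hx0 ▸ hp))

/-- **THE STAGE FROM THE POST-RAMP BOX AT LEVEL `c > 0`**: input `c • PostBox24`, output `ã ≥ c·zL`,
defect `c²·Gt.δ`, cycle `(TfromT 24 + T₃L)/c`. [cite: Tao2016AveragedNS, §5.5 Thm 5.3 (5.5); §6.1 Remark 6.1] -/
def postBox24StageLevel {c : ℝ} (hc : 0 < c) :
    ReachCertificate (thresholdCircuit Gt.ε Gt.σ Gt.ν Gt.μ Gt.r Gt.κ) univ (c ^ 2 * Gt.δ)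
      ((TfromT 24 + T₃L) / c) (c • PostBox24) (outputAbove (c * zL)) :=
  certificateCast
    (certificateRescale (thresholdCircuit_smul Gt.ε Gt.σ Gt.ν Gt.μ Gt.r Gt.κ) (postBox24Stage) hc)
    (smul_univ_fin5 hc.ne') rfl rfl rfl (smul_outputAbove hc zL)

/-! ### The join with the thin design tube (containment test: `TubeSection.boxSubCrit`) -/

/-- The containment test passes at every chunk boundary `j ∈ [J1, NP24]`. [folklore] -/
theorem boxSubCrit_sP24 : ∀ j, J1 ≤ j → j ≤ NP24 →
    boxSubCrit (sP24 j).B (sT (24 + j)).B (lamP j).1 (lamP j).2 = true := by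
  intro j h1 h2
  simp only [J1, NP24] at h1 h2
  interval_cases j <;> decide

/-- **THE POST-RAMP TUBE JOINS THE THIN DESIGN TUBE**: every `Gt.δ`-forced window from `PostBox24` of
duration at least `dur (schedToP j)` lies at the chunk boundary instant `j ∈ [J1, NP24]` in the design section
`sT (24 + j)` (real form) — by the soundness of the kernel run up to chunk `j` and the containment test.
[cite: Tao2016AveragedNS, §5.5 Thm 5.3 (5.5)] -/
theorem postBox24_joins_section {j : ℕ} (hj1 : J1 ≤ j) (hj2 : j ≤ NP24) {z : ℝ → Fin 5 → ℝ}
    (hW : IsForcedWindow Gt.ε Gt.σ Gt.ν Gt.μ Gt.r Gt.κ Gt.δ (dur ((List.range j).flatMap cP24)) z)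
    (h0 : z 0 ∈ PostBox24) :
    ((sT (24 + j)).B.toR 60).mem (z (dur ((List.range j).flatMap cP24))) := by
  have hrun := run_prefixP24 hj2
  obtain ⟨hend, -, -, -⟩ := runTube_sound (P := 60) (n := 12) (by norm_num) GIt_mem Gt_valid CLt Rt _ _ _
    hrun z hW h0
  exact mem_of_boxSubCrit (boxSubCrit_sP24 j hj1 hj2) hend

end TubeStage

end Summit.NavierStokesRegularity.FluidComputer

end
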